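import Literature.NumberTheory.Transcendental.CurvePeriods
import Summits.KontsevichZagierPeriods.KontsevichZagierPeriods.Theorems.FermatIsogenyBetaLinearSectorStubFermatSymbolData
import Mathlib.Analysis.SpecialFunctions.Pow.Continuity
import Mathlib.Analysis.SpecialFunctions.Pow.Complex
import Mathlib.Analysis.SpecialFunctions.Pow.Real
import Mathlib.Analysis.SpecialFunctions.Complex.Arg
import Mathlib.Analysis.SpecialFunctions.Complex.Log
import Mathlib.Analysis.Convex.Star
import Mathlib.Algebra.Polynomial.Roots
import Mathlib.Topology.Connected.TotallyDisconnected
import Mathlib.Topology.Separation.Basic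
import HarnessLib

/-!
# `BetaLinearSector` (stmt-KontsevichZagierPeriods-3897), line `fermat-sector-transport`:
# auxiliaries for SECTOR STUB B1 `stub_sectorChart` (the sector chart on the Fermat curve)

On the affine Fermat curve `F_N = {x^N + y^N = 1}` the SECTOR CHART is
`Y(z) = exp(−iπ/(2N)) · (i(1 − z^N))^{1/N}` (principal power).  General lemmas:

* the constants: `exp(−iπ/(2N))^N = −i`, `ε^N = ε̄^N = −1` (`ε = e^{iπ/N}`), `ε ε̄ = 1`;
* the principal `N`-th roots `exp(−iπ/(2N)) (i r)^{1/N} = r^{1/N}` and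
  `exp(−iπ/(2N)) (−i r)^{1/N} = ε̄ r^{1/N}` for real `r ≥ 0`;
* `Y(z)^N = 1 − z^N`, so `Φ(z) = (z, Y z) ∈ F_N`; `Y(x) = y` for real `x`, `y ≥ 0` on `F_N`;
* continuity of `Y` on `S⁺ = {0 ≤ Im z^N}` (the base `i(1 − z^N)` has real part `Im z^N ≥ 0`) and on
  `S⁻ = {Im u^N ≤ 0, |u^N| ≤ 1, u^N ≠ 1}` (the base has imaginary part `1 − Re u^N ≠ 0`), via
  `Complex.continuousAt_cpow_const_of_re_pos`; star-convexity of `S⁺`, `S⁻` at `0`;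
* the frontier `x_f(t) = (2−t)^{1/N} e^{iπt/N}`: `x_f^N = (2−t)e^{iπt}`, the memberships `x_f ∈ S⁺`,
  `1/x_f ∈ S⁻` on `[0,1]`, the value at `t = 0`, and the CONNECTEDNESS lemma behind the frontier
  identity (two continuous `N`-th roots of the same nonvanishing function on `[0,1]` that agree at
  `0` agree everywhere: their quotient maps the connected `[0,1]` into the finite set of `N`-th roots
  of unity).

References: B. Gross, *On the periods of abelian integrals and a formula of Chowla and Selberg*
(1978), §1 (with Rohrlich's appendix); A. Huber, G. Wüstholz, *Transcendence and Linear Relations of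
1-Periods* (2022), §3.3.1.  No definition, no named fact.
-/

noncomputable section

open scoped BigOperators unitInterval
open MeasureTheory Set MvPolynomial
open Literature.NumberTheory.Transcendental Literature.NumberTheory.Transcendental.CurvePeriods

namespace Summit.KontsevichZagierPeriods.FermatIsogeny.BetaLinearSector

/-! ## The constants `exp(−iπ/(2N))`, `ε = exp(iπ/N)`, `ε̄ = exp(−iπ/N)` -/

/-- `exp(−iπ/(2N))^N = −i`. [folklore] -/
theorem sectorChart_const_pow {N : ℕ} (hN : N ≠ 0) :
    Complex.exp (-(↑Real.pi * Complex.I / (2 * (N : ℂ)))) ^ N = -Complex.I := by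
  rw [← Complex.exp_nat_mul, ← Complex.exp_neg_pi_div_two_mul_I]
  congr 1
  have hNc : (N : ℂ) ≠ 0 := Nat.cast_ne_zero.2 hN
  field_simp

/-- `ε^N = exp(iπ/N)^N = −1`. [folklore] -/
theorem sectorChart_eps_pow {N : ℕ} (hN : N ≠ 0) :
    Complex.exp (↑Real.pi * Complex.I / (N : ℂ)) ^ N = -1 := by
  rw [← Complex.exp_nat_mul, ← Complex.exp_pi_mul_I]
  congr 1
  have hNc : (N : ℂ) ≠ 0 := Nat.cast_ne_zero.2 hN
  field_simp

/-- `ε̄^N = exp(−iπ/N)^N = −1`. [folklore] -/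
theorem sectorChart_epsBar_pow {N : ℕ} (hN : N ≠ 0) :
    Complex.exp (-(↑Real.pi * Complex.I / (N : ℂ))) ^ N = -1 := by
  rw [Complex.exp_neg, inv_pow, sectorChart_eps_pow hN]
  norm_num

/-- `ε ε̄ = 1`. [folklore] -/
theorem sectorChart_eps_mul_epsBar (N : ℕ) :
    Complex.exp (↑Real.pi * Complex.I / (N : ℂ)) * Complex.exp (-(↑Real.pi * Complex.I / (N : ℂ))) = 1 := by
  rw [Complex.exp_neg, mul_inv_cancel₀ (Complex.exp_ne_zero _)]

/-! ## The principal `N`-th root of `± i r`, `r ≥ 0` -/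

/-- `exp(−iπ/(2N)) · (i r)^{1/N} = r^{1/N}` for real `r ≥ 0` (principal branch: `arg(i r) = π/2`).
[folklore] -/
theorem sectorChart_root_pos {N : ℕ} (hN : N ≠ 0) {r : ℝ} (hr : 0 ≤ r) :
    Complex.exp (-(↑Real.pi * Complex.I / (2 * (N : ℂ)))) * (Complex.I * (r : ℂ)) ^ ((N : ℂ)⁻¹) =
      ((r ^ ((N : ℝ)⁻¹) : ℝ) : ℂ) := by
  have hNc : (N : ℂ) ≠ 0 := Nat.cast_ne_zero.2 hN
  have hNr : (N : ℝ) ≠ 0 := Nat.cast_ne_zero.2 hN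
  rcases hr.eq_or_lt with h0 | hpos
  · rw [← h0, Complex.ofReal_zero, mul_zero, Complex.zero_cpow (inv_ne_zero hNc), mul_zero,
      Real.zero_rpow (inv_ne_zero hNr), Complex.ofReal_zero]
  · have hI : Complex.I ≠ 0 := Complex.I_ne_zero
    rw [mul_comm Complex.I, Complex.cpow_def_of_ne_zero (mul_ne_zero (Complex.ofReal_ne_zero.2 hpos.ne') hI),
      Complex.log_ofReal_mul hpos hI, Complex.log_I, ← Complex.exp_add, Real.rpow_def_of_pos hpos,
      Complex.ofReal_exp]
    congr 1
    push_cast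
    field_simp
    ring

/-- `exp(−iπ/(2N)) · (−i r)^{1/N} = ε̄ · r^{1/N}` for real `r ≥ 0` (principal branch:
`arg(−i r) = −π/2`). [folklore] -/
theorem sectorChart_root_neg {N : ℕ} (hN : N ≠ 0) {r : ℝ} (hr : 0 ≤ r) :
    Complex.exp (-(↑Real.pi * Complex.I / (2 * (N : ℂ)))) * (Complex.I * (-(r : ℂ))) ^ ((N : ℂ)⁻¹) =
      Complex.exp (-(↑Real.pi * Complex.I / (N : ℂ))) * ((r ^ ((N : ℝ)⁻¹) : ℝ) : ℂ) := by
  have hNc : (N : ℂ) ≠ 0 := Nat.cast_ne_zero.2 hN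
  have hNr : (N : ℝ) ≠ 0 := Nat.cast_ne_zero.2 hN
  rcases hr.eq_or_lt with h0 | hpos
  · rw [← h0, Complex.ofReal_zero, neg_zero, mul_zero, Complex.zero_cpow (inv_ne_zero hNc), mul_zero,
      Real.zero_rpow (inv_ne_zero hNr), Complex.ofReal_zero, mul_zero]
  · have hI : -Complex.I ≠ 0 := neg_ne_zero.2 Complex.I_ne_zero
    rw [show Complex.I * (-(r : ℂ)) = (r : ℂ) * (-Complex.I) by ring,
      Complex.cpow_def_of_ne_zero (mul_ne_zero (Complex.ofReal_ne_zero.2 hpos.ne') hI),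
      Complex.log_ofReal_mul hpos hI, Complex.log_neg_I, ← Complex.exp_add, Real.rpow_def_of_pos hpos,
      Complex.ofReal_exp, ← Complex.exp_add]
    congr 1
    push_cast
    field_simp
    ring

/-! ## `Y(z)^N = 1 − z^N` and `Φ(z) = (z, Y z) ∈ F_N` -/

/-- `Y(z)^N = 1 − z^N` for the sector chart `Y(z) = exp(−iπ/(2N)) (i(1 − z^N))^{1/N}`.
[cite: Gross1978, §1] -/
theorem sectorChart_pow {N : ℕ} (hN : N ≠ 0) (z : ℂ) :
    (Complex.exp (-(↑Real.pi * Complex.I / (2 * (N : ℂ)))) * (Complex.I * (1 - z ^ N)) ^ ((N : ℂ)⁻¹)) ^ N =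
      1 - z ^ N := by
  rw [mul_pow, Complex.cpow_nat_inv_pow _ hN, sectorChart_const_pow hN, ← mul_assoc]
  have h : -Complex.I * Complex.I = 1 := by rw [neg_mul, Complex.I_mul_I, neg_neg]
  rw [h, one_mul]

/-- (a) `Φ(z) = (z, Y z)` lies on `F_N`. [cite: Gross1978, §1] -/
theorem sectorChart_mem_points {N : ℕ} (hN : N ≠ 0) (z : ℂ) :
    (![z, Complex.exp (-(↑Real.pi * Complex.I / (2 * (N : ℂ)))) * (Complex.I * (1 - z ^ N)) ^ ((N : ℂ)⁻¹)] :
        Fin 2 → ℂ) ∈ (⟨2, 1, ![X 0 ^ N + X 1 ^ N - 1]⟩ : CurveData).points := by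
  rw [mem_points_fermat_iff]
  simp only [Matrix.cons_val_zero, Matrix.cons_val_one]
  rw [sectorChart_pow hN]
  ring

/-! ## Continuity of `Y` on `S⁺` and `S⁻`; star-convexity -/

/-- `Y` is continuous at every `z` whose base `i(1 − z^N)` is off the closed negative real axis
(nonnegative real part, or nonzero imaginary part). [folklore] -/
theorem sectorChart_continuousAt {N : ℕ} (hN : N ≠ 0) {z : ℂ}
    (hz : 0 ≤ (Complex.I * (1 - z ^ N)).re ∨ (Complex.I * (1 - z ^ N)).im ≠ 0) :
    ContinuousAt (fun z : ℂ => Complex.exp (-(↑Real.pi * Complex.I / (2 * (N : ℂ)))) *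
      (Complex.I * (1 - z ^ N)) ^ ((N : ℂ)⁻¹)) z := by
  have hw : 0 < ((N : ℂ)⁻¹).re := by
    have h : ((N : ℂ)⁻¹) = (((N : ℝ)⁻¹ : ℝ) : ℂ) := by push_cast; rfl
    rw [h, Complex.ofReal_re]
    exact inv_pos.2 (Nat.cast_pos.2 (Nat.pos_of_ne_zero hN))
  have h1 : ContinuousAt (fun w : ℂ => w ^ ((N : ℂ)⁻¹)) (Complex.I * (1 - z ^ N)) :=
    Complex.continuousAt_cpow_const_of_re_pos hz hw
  have h2 : ContinuousAt (fun z : ℂ => Complex.I * (1 - z ^ N)) z :=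
    (continuous_const.mul (continuous_const.sub (continuous_pow N))).continuousAt
  have h3 : ContinuousAt (fun z : ℂ => (Complex.I * (1 - z ^ N)) ^ ((N : ℂ)⁻¹)) z :=
    ContinuousAt.comp (f := fun z : ℂ => Complex.I * (1 - z ^ N)) (x := z) h1 h2
  exact continuousAt_const.mul h3

/-- (b) `Y` is continuous on `S⁺ = {0 ≤ Im z^N}` (there `Re(i(1 − z^N)) = Im z^N ≥ 0`).
[cite: Gross1978, §1] -/
theorem sectorChart_continuousOn_plus {N : ℕ} (hN : N ≠ 0) :
    ContinuousOn (fun z : ℂ => Complex.exp (-(↑Real.pi * Complex.I / (2 * (N : ℂ)))) *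
      (Complex.I * (1 - z ^ N)) ^ ((N : ℂ)⁻¹)) {z : ℂ | 0 ≤ (z ^ N).im} := fun z hz =>
  (sectorChart_continuousAt hN (Or.inl (by simpa using hz))).continuousWithinAt

/-- If `‖w‖ ≤ 1` and `w ≠ 1` then `Re w ≠ 1`. [folklore] -/
theorem sectorChart_re_ne_one {w : ℂ} (h1 : ‖w‖ ≤ 1) (h2 : w ≠ 1) : w.re ≠ 1 := by
  intro hre
  apply h2
  have him : w.im = 0 := by
    have h3 : ‖w‖ ^ 2 ≤ 1 := by nlinarith [norm_nonneg w]
    rw [Complex.sq_norm, Complex.normSq_apply, hre] at h3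
    nlinarith [sq_nonneg w.im]
  exact Complex.ext (by simp [hre]) (by simp [him])

/-- (c) `Y` is continuous on `S⁻ = {Im u^N ≤ 0, |u^N| ≤ 1, u^N ≠ 1}` (there
`Im(i(1 − u^N)) = 1 − Re u^N ≠ 0`). [cite: Gross1978, §1] -/
theorem sectorChart_continuousOn_minus {N : ℕ} (hN : N ≠ 0) :
    ContinuousOn (fun z : ℂ => Complex.exp (-(↑Real.pi * Complex.I / (2 * (N : ℂ)))) *
      (Complex.I * (1 - z ^ N)) ^ ((N : ℂ)⁻¹)) {u : ℂ | (u ^ N).im ≤ 0 ∧ ‖u ^ N‖ ≤ 1 ∧ u ^ N ≠ 1} :=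
  fun u hu => by
    refine (sectorChart_continuousAt hN (Or.inr ?_)).continuousWithinAt
    have h := sectorChart_re_ne_one hu.2.1 hu.2.2
    have him : (Complex.I * (1 - u ^ N)).im = 1 - (u ^ N).re := by simp
    rw [him]
    intro h0
    exact h (by linarith)

/-- (b) `S⁺ = {0 ≤ Im z^N}` is star-shaped at `0` (`(b z)^N = b^N z^N`, `b ≥ 0`). [folklore] -/
theorem sectorChart_starConvex_plus (N : ℕ) : StarConvex ℝ (0 : ℂ) {z : ℂ | 0 ≤ (z ^ N).im} := by
  intro y hy a b _ hb _
  simp only [smul_zero, zero_add, Set.mem_setOf_eq, Complex.real_smul] at hy ⊢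
  rw [mul_pow, ← Complex.ofReal_pow, Complex.im_ofReal_mul]
  exact mul_nonneg (pow_nonneg hb N) hy

/-- (c) `S⁻ = {Im u^N ≤ 0, |u^N| ≤ 1, u^N ≠ 1}` is star-shaped at `0` (`(b u)^N = b^N u^N` with
`0 ≤ b^N ≤ 1`, and `b^N u^N = 1` forces `b^N = 1`, `u^N = 1`). [folklore] -/
theorem sectorChart_starConvex_minus (N : ℕ) :
    StarConvex ℝ (0 : ℂ) {u : ℂ | (u ^ N).im ≤ 0 ∧ ‖u ^ N‖ ≤ 1 ∧ u ^ N ≠ 1} := by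
  intro y hy a b ha hb hab
  obtain ⟨h1, h2, h3⟩ := hy
  simp only [smul_zero, zero_add, Set.mem_setOf_eq, Complex.real_smul]
  have hb1 : b ≤ 1 := by linarith
  have hbN : b ^ N ≤ 1 := pow_le_one₀ hb hb1
  have hbN0 : 0 ≤ b ^ N := pow_nonneg hb N
  rw [mul_pow, ← Complex.ofReal_pow]
  refine ⟨?_, ?_, ?_⟩
  · rw [Complex.im_ofReal_mul]
    exact mul_nonpos_of_nonneg_of_nonpos hbN0 h1
  · rw [norm_mul, Complex.norm_real, Real.norm_of_nonneg hbN0]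
    calc b ^ N * ‖y ^ N‖ ≤ 1 * 1 := mul_le_mul hbN h2 (norm_nonneg _) zero_le_one
      _ = 1 := one_mul 1
  · intro h
    have hn : b ^ N * ‖y ^ N‖ = 1 := by
      have h' := congrArg (fun w : ℂ => ‖w‖) h
      simpa only [norm_mul, Complex.norm_real, Real.norm_of_nonneg hbN0, norm_one] using h'
    have hbN1 : b ^ N = 1 := by
      by_contra hne
      have hlt : b ^ N < 1 := lt_of_le_of_ne hbN hne
      have : b ^ N * ‖y ^ N‖ < 1 := by nlinarith [norm_nonneg (y ^ N)]
      linarith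
    rw [hbN1, Complex.ofReal_one, one_mul] at h
    exact h3 h

/-! ## The value of `Y` at real points of `F_N` -/

/-- On the real arc: `x, y` real, `y ≥ 0`, `x^N + y^N = 1` ⇒ `Y(x) = y`. [cite: Gross1978, §1] -/
theorem sectorChart_real {N : ℕ} (hN : N ≠ 0) {x y : ℝ} (hy : 0 ≤ y) (h : x ^ N + y ^ N = 1) :
    Complex.exp (-(↑Real.pi * Complex.I / (2 * (N : ℂ)))) * (Complex.I * (1 - (x : ℂ) ^ N)) ^ ((N : ℂ)⁻¹) =
      (y : ℂ) := by
  have h1 : (1 : ℂ) - (x : ℂ) ^ N = ((y ^ N : ℝ) : ℂ) := by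
    have h' : (1 : ℝ) - x ^ N = y ^ N := by linarith
    rw [← h']
    push_cast
    ring
  rw [h1, sectorChart_root_pos hN (pow_nonneg hy N), Real.pow_rpow_inv_natCast hy hN]

/-! ## The frontier `x_f(t) = (2−t)^{1/N} e^{iπt/N}` -/

/-- `x_f(t)^N = (2 − t) e^{iπt}`. [folklore] -/
theorem sectorChart_frontier_pow {N : ℕ} (hN : N ≠ 0) {t : ℝ} (ht : t ≤ 2) :
    (((((2:ℝ) - t) ^ ((N:ℝ)⁻¹) : ℝ) : ℂ) * Complex.exp (↑Real.pi * Complex.I * (t : ℂ) / (N : ℂ))) ^ N =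
      ((((2:ℝ) - t) : ℝ) : ℂ) * Complex.exp (((Real.pi * t : ℝ) : ℂ) * Complex.I) := by
  have hNc : (N : ℂ) ≠ 0 := Nat.cast_ne_zero.2 hN
  rw [mul_pow, ← Complex.ofReal_pow, Real.rpow_inv_natCast_pow (by linarith) hN, ← Complex.exp_nat_mul,
    show (N : ℂ) * (↑Real.pi * Complex.I * (t : ℂ) / (N : ℂ)) = ((Real.pi * t : ℝ) : ℂ) * Complex.I by
      push_cast; field_simp; try ring]

/-- (h, memberships) for `t ∈ [0,1]`: `x_f(t) ∈ S⁺` (`Im x_f^N = (2−t) sin πt ≥ 0`) and `1/x_f(t) ∈ S⁻`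
(`x_f^{−N} = (2−t)^{−1} e^{−iπt}` has `Im ≤ 0`, norm `≤ 1`, and is `≠ 1`). [cite: Gross1978, §1] -/
theorem sectorChart_frontier_mem {N : ℕ} (hN : N ≠ 0) : ∀ t ∈ Set.Icc (0:ℝ) 1,
      0 ≤ ((((((2:ℝ) - t) ^ ((N:ℝ)⁻¹) : ℝ) : ℂ) * Complex.exp (↑Real.pi * Complex.I * (t : ℂ) / (N : ℂ))) ^ N).im ∧
      (((((((2:ℝ) - t) ^ ((N:ℝ)⁻¹) : ℝ) : ℂ) * Complex.exp (↑Real.pi * Complex.I * (t : ℂ) / (N : ℂ)))⁻¹) ^ N).im ≤ 0 ∧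
      ‖((((((2:ℝ) - t) ^ ((N:ℝ)⁻¹) : ℝ) : ℂ) * Complex.exp (↑Real.pi * Complex.I * (t : ℂ) / (N : ℂ)))⁻¹) ^ N‖ ≤ 1 ∧
      ((((((2:ℝ) - t) ^ ((N:ℝ)⁻¹) : ℝ) : ℂ) * Complex.exp (↑Real.pi * Complex.I * (t : ℂ) / (N : ℂ)))⁻¹) ^ N ≠ 1 := by
  intro t ht
  have h2t : 0 < (2:ℝ) - t := by linarith [ht.2]
  have hpow := sectorChart_frontier_pow hN (by linarith [ht.2] : t ≤ 2)
  have hsin : 0 ≤ Real.sin (Real.pi * t) :=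
    Real.sin_nonneg_of_nonneg_of_le_pi (mul_nonneg Real.pi_pos.le ht.1) (by nlinarith [Real.pi_pos, ht.2])
  have hinv : ((((((2:ℝ) - t) ^ ((N:ℝ)⁻¹) : ℝ) : ℂ) *
      Complex.exp (↑Real.pi * Complex.I * (t : ℂ) / (N : ℂ)))⁻¹) ^ N =
      ((((2:ℝ) - t)⁻¹ : ℝ) : ℂ) * Complex.exp (((-(Real.pi * t)) : ℝ) * Complex.I) := by
    rw [inv_pow, hpow, mul_inv, ← Complex.exp_neg, Complex.ofReal_inv,
      show -(((Real.pi * t : ℝ) : ℂ) * Complex.I) = ((-(Real.pi * t) : ℝ) : ℂ) * Complex.I by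
        push_cast; ring]
  refine ⟨?_, ?_, ?_, ?_⟩
  · rw [hpow, Complex.im_ofReal_mul, Complex.exp_ofReal_mul_I_im]
    exact mul_nonneg h2t.le hsin
  · rw [hinv, Complex.im_ofReal_mul, Complex.exp_ofReal_mul_I_im, Real.sin_neg]
    exact mul_nonpos_of_nonneg_of_nonpos (inv_nonneg.2 h2t.le) (neg_nonpos.2 hsin)
  · rw [hinv, norm_mul, Complex.norm_exp_ofReal_mul_I, mul_one, Complex.norm_real,
      Real.norm_of_nonneg (inv_nonneg.2 h2t.le)]
    exact inv_le_one_of_one_le₀ (by linarith [ht.2])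
  · rw [hinv]
    intro h1
    have hn := congrArg (fun w : ℂ => ‖w‖) h1
    simp only [norm_mul, Complex.norm_exp_ofReal_mul_I, mul_one, Complex.norm_real,
      Real.norm_of_nonneg (inv_nonneg.2 h2t.le), norm_one] at hn
    have ht1 : t = 1 := by
      have h3 : (2:ℝ) - t = 1 := by
        have h4 := congrArg (fun r : ℝ => r⁻¹) hn
        simpa using h4
      linarith
    rw [ht1] at h1
    have h5 : Complex.exp (((-(Real.pi * 1)) : ℝ) * Complex.I) = -1 := by
      rw [mul_one, Complex.ofReal_neg, neg_mul, Complex.exp_neg, Complex.exp_pi_mul_I]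
      norm_num
    rw [h5] at h1
    norm_num at h1

/-- (h, at `t = 0`): `x_f(0) = 2^{1/N}` and `ε Y(2^{1/N})/2^{1/N} = ε ε̄ / 2^{1/N} = Y(2^{−1/N})`.
[cite: Gross1978, §1] -/
theorem sectorChart_frontier_zero {N : ℕ} (hN : N ≠ 0) :
    Complex.exp (↑Real.pi * Complex.I / (N : ℂ)) *
        (Complex.exp (-(↑Real.pi * Complex.I / (2 * (N : ℂ)))) *
          (Complex.I * (1 - (((((2:ℝ) - 0) ^ ((N:ℝ)⁻¹) : ℝ) : ℂ) *
            Complex.exp (↑Real.pi * Complex.I * ((0:ℝ) : ℂ) / (N : ℂ))) ^ N)) ^ ((N : ℂ)⁻¹)) /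
        (((((2:ℝ) - 0) ^ ((N:ℝ)⁻¹) : ℝ) : ℂ) * Complex.exp (↑Real.pi * Complex.I * ((0:ℝ) : ℂ) / (N : ℂ))) =
      Complex.exp (-(↑Real.pi * Complex.I / (2 * (N : ℂ)))) *
        (Complex.I * (1 - ((((((2:ℝ) - 0) ^ ((N:ℝ)⁻¹) : ℝ) : ℂ) *
          Complex.exp (↑Real.pi * Complex.I * ((0:ℝ) : ℂ) / (N : ℂ)))⁻¹) ^ N)) ^ ((N : ℂ)⁻¹) := by
  have ha : (0:ℝ) < (2:ℝ) ^ ((N:ℝ)⁻¹) := Real.rpow_pos_of_pos two_pos _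
  have haN : ((2:ℝ) ^ ((N:ℝ)⁻¹)) ^ N = 2 := Real.rpow_inv_natCast_pow zero_le_two hN
  have hx0 : ((((2:ℝ) - 0) ^ ((N:ℝ)⁻¹) : ℝ) : ℂ) * Complex.exp (↑Real.pi * Complex.I * ((0:ℝ) : ℂ) / (N : ℂ)) =
      (((2:ℝ) ^ ((N:ℝ)⁻¹) : ℝ) : ℂ) := by
    simp
  rw [hx0]
  have h1 : (1 : ℂ) - (((2:ℝ) ^ ((N:ℝ)⁻¹) : ℝ) : ℂ) ^ N = -(((1:ℝ)) : ℂ) := by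
    rw [← Complex.ofReal_pow, haN]
    push_cast
    norm_num
  have h2 : ((2:ℝ) ^ ((N:ℝ)⁻¹))⁻¹ ^ N + ((2:ℝ) ^ ((N:ℝ)⁻¹))⁻¹ ^ N = 1 := by
    rw [inv_pow, haN]
    norm_num
  rw [show Complex.I * (1 - (((2:ℝ) ^ ((N:ℝ)⁻¹) : ℝ) : ℂ) ^ N) = Complex.I * (-(((1:ℝ)) : ℂ)) by rw [h1],
    sectorChart_root_neg hN zero_le_one, Real.one_rpow, Complex.ofReal_one, mul_one,
    sectorChart_eps_mul_epsBar, ← Complex.ofReal_inv, sectorChart_real hN (inv_nonneg.2 ha.le) h2,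
    Complex.ofReal_inv, one_div]

/-- CONNECTEDNESS: two functions `q, p` continuous on `[0,1]` with `q^N = p^N`, `p ≠ 0` there and
`q(0) = p(0)` coincide on `[0,1]` (`q/p` is a continuous map of the connected `[0,1]` into the
finite set of `N`-th roots of unity, hence constant). [folklore] -/
theorem sectorChart_eq_of_pow_eq {N : ℕ} (hN : N ≠ 0) {q p : ℝ → ℂ}
    (hq : ContinuousOn q (Set.Icc (0:ℝ) 1)) (hp : ContinuousOn p (Set.Icc (0:ℝ) 1))
    (hp0 : ∀ t ∈ Set.Icc (0:ℝ) 1, p t ≠ 0) (hpow : ∀ t ∈ Set.Icc (0:ℝ) 1, q t ^ N = p t ^ N)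
    (h0 : q 0 = p 0) : ∀ t ∈ Set.Icc (0:ℝ) 1, q t = p t := by
  have hfin : Set.Finite {ζ : ℂ | ζ ^ N = 1} := by
    refine (Polynomial.nthRoots N (1 : ℂ)).toFinset.finite_toSet.subset ?_
    intro ζ hζ
    simp only [Finset.mem_coe, Multiset.mem_toFinset, Polynomial.mem_nthRoots (Nat.pos_of_ne_zero hN)]
    exact hζ
  have hg : ContinuousOn (fun t => q t / p t) (Set.Icc (0:ℝ) 1) := hq.div hp hp0
  have hmaps : Set.MapsTo (fun t => q t / p t) (Set.Icc (0:ℝ) 1) {ζ : ℂ | ζ ^ N = 1} := by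
    intro t ht
    simp only [Set.mem_setOf_eq]
    rw [div_pow, hpow t ht, div_self (pow_ne_zero N (hp0 t ht))]
  intro t ht
  have h01 : (0:ℝ) ∈ Set.Icc (0:ℝ) 1 := ⟨le_rfl, zero_le_one⟩
  have hconst := isPreconnected_Icc.constant_of_mapsTo hfin.isDiscrete hg hmaps ht h01
  rw [h0, div_self (hp0 0 h01)] at hconst
  exact (div_eq_one_iff_eq (hp0 t ht)).1 hconst

/-- THE FRONTIER IDENTITY, abstract form: if `ε^N = −1`, `Y(z)^N = 1 − z^N`, `Y` is continuous on `S⁺`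
and on `S⁻`, `x : [0,1] → ℂˣ` is continuous with `x(t) ∈ S⁺`, `1/x(t) ∈ S⁻`, and
`ε Y(x(0))/x(0) = Y(1/x(0))`, then `ε Y(x(t))/x(t) = Y(1/x(t))` on `[0,1]` (both sides are continuous
`N`-th roots of `1 − x^{−N} ≠ 0`). [cite: Gross1978, §1] -/
theorem sectorChart_frontier_abstract {N : ℕ} (hN : N ≠ 0) (ε : ℂ) (hε : ε ^ N = -1)
    (Y : ℂ → ℂ) (hYpow : ∀ z, Y z ^ N = 1 - z ^ N)
    (hYp : ContinuousOn Y {z : ℂ | 0 ≤ (z ^ N).im})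
    (hYm : ContinuousOn Y {u : ℂ | (u ^ N).im ≤ 0 ∧ ‖u ^ N‖ ≤ 1 ∧ u ^ N ≠ 1})
    (xf : ℝ → ℂ) (hxfc : Continuous xf) (hxf0 : ∀ t ∈ Set.Icc (0:ℝ) 1, xf t ≠ 0)
    (hmem : ∀ t ∈ Set.Icc (0:ℝ) 1, 0 ≤ ((xf t) ^ N).im ∧ (((xf t)⁻¹) ^ N).im ≤ 0 ∧
      ‖((xf t)⁻¹) ^ N‖ ≤ 1 ∧ ((xf t)⁻¹) ^ N ≠ 1)
    (h0 : ε * Y (xf 0) / xf 0 = Y ((xf 0)⁻¹)) :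
    ∀ t ∈ Set.Icc (0:ℝ) 1, ε * Y (xf t) / xf t = Y ((xf t)⁻¹) := by
  refine sectorChart_eq_of_pow_eq hN (q := fun t => ε * Y (xf t) / xf t) (p := fun t => Y ((xf t)⁻¹))
    ?_ ?_ ?_ ?_ h0
  · have h1 : ContinuousOn (fun t => Y (xf t)) (Set.Icc (0:ℝ) 1) :=
      hYp.comp hxfc.continuousOn fun t ht => (hmem t ht).1
    exact (continuousOn_const.mul h1).div hxfc.continuousOn hxf0
  · have h1 : ContinuousOn (fun t => (xf t)⁻¹) (Set.Icc (0:ℝ) 1) := hxfc.continuousOn.inv₀ hxf0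
    exact hYm.comp h1 fun t ht => (hmem t ht).2
  · intro t ht hpt
    have h := hYpow ((xf t)⁻¹)
    rw [hpt, zero_pow hN] at h
    exact (hmem t ht).2.2.2 (by linear_combination h)
  · intro t ht
    have hx := hxf0 t ht
    have hxN : (xf t) ^ N ≠ 0 := pow_ne_zero N hx
    rw [div_pow, mul_pow, hε, hYpow, hYpow, inv_pow]
    field_simp
    ring

/-! ## Registered auxiliary anchor -/

/-- `Y(z)^N = 1 − z^N` for the sector chart `Y(z) = exp(−iπ/(2N)) (i(1 − z^N))^{1/N}`, `N ≠ 0`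
(so `Φ(z) = (z, Y z) ∈ F_N`).  Registered auxiliary anchor of this aux file of `stub_sectorChart`.
[cite: Gross1978, §1] -/
theorem sectorChart_aux_pow : ∀ {N : ℕ}, N ≠ 0 → ∀ (z : ℂ),
    (Complex.exp (-(↑Real.pi * Complex.I / (2 * (N : ℂ)))) * (Complex.I * (1 - z ^ N)) ^ ((N : ℂ)⁻¹)) ^ N =
      1 - z ^ N :=
  fun hN z => sectorChart_pow hN z

end Summit.KontsevichZagierPeriods.FermatIsogeny.BetaLinearSector

end
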